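import Summits.BirchSwinnertonDyer.Rank1Residual.Supersingular.BlindInterpolationFlatTwoUnit
import Summits.BirchSwinnertonDyer.Rank1Residual.Supersingular.SprungPollackConsistency
import Summits.BirchSwinnertonDyer.Rank1Residual.Supersingular.KobayashiMainConjecture
import Summits.BirchSwinnertonDyer.Rank1Residual.Supersingular.FrobeniusTraceTwoParity
import Literature.NumberTheory.EllipticCurves.Sprung2017.SharpFlatPAdicLFunctionTwoProofs
import HarnessLib

/-!
# Route `ByReductionTypeAtTwo` (rung K4), crux `SupersingularRankZeroAtTwo` (item
# stmt-BirchSwinnertonDyer-19097): the `♯` CONSTANT TERM of Sprung's pair at `p = 2`, non-vanishing of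
# the pair in analytic rank `0`, and the POLLACK PAIR AT `2` for `a₂ = 0` (helper, seat `bsd-2adic-ss-1`)

HONEST FRAMING (cell `bsd-2adic`, run/shared/lean/pub/bsd-2adic/, HUMAN RULINGS D-0036/D-0059/D-0074):
THEOREMS ONLY about the tree's objects (`ratPlusSymbol`, `mazurTateElement`, `IsSprungPair`,
`IsPollackPair`); nothing asserted about any Selmer group; no definition, no named fact; nothing booked.
PARTITION (D-0054): X5@2 good-SUPERSINGULAR (B1·O1; 763 book230 classes) × p = 2 —
types-the-object-of; closes none. This file supplies the analytic inputs at `2` that the sibling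
bridge file `ByReductionTypeAtTwoSupersingularInputs.lean` needs to state the `a₂ = 0` block of the
crux on REAL objects (`KobayashiMainConjecture W 2 1` quantifies over `IsPollackPair f 2`, whose two
non-vanishing clauses must be met by Sprung's pair at `2`).

## What is proved (all `p`-uniform statements are stated for any prime `p`)

* `sum_units_ratPlusSymbol_val_div_eq` — `∑_{a ∈ (ℤ/p²)ˣ} [a/p]⁺_f = p·(a_p − 2)·[0]⁺_f` (the units
  modulo `p²` lie `p`-to-`1` over the units modulo `p`, `[r + j]⁺ = [r]⁺`);
* `sum_units_ratPlusSymbol_level_three_eq` — **`∑_{a ∈ (ℤ/p³)ˣ} [a/p³]⁺_f =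
  (a_p³ − 2a_p² + (1 − 2p)a_p + 2p)·[0]⁺_f`** (fibre over `ℤ/p²`: `a_p·S₂ − p·S₁` with the tree's
  `sum_units_ratPlusSymbol_level_two_eq` / `…_level_one_eq`; Mazur–Tate–Teitelbaum (4.2));
* `constantCoeff_sharp_two_of_isCongrModOmega_one`, `…_of_isSprungPair_of_isNewformOf` —
  **`L♯(0) = (−a₂³ + 2a₂² + 3a₂ − 4)·[0]⁺_f` at `p = 2`** (`θ_1` lives at level `2^{1+2} = 8`, and
  `θ_1 ≡ −L♯ (mod ω_1)`): the `♯` entry `c♯ ∈ {−4, 2, 6}` for `a₂ = 0, 2, −2` of the row `p = 2` of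
  Sprung's table of special values (ANT 11 (2017) after Cor. 4.11), the companion of the tree's `♭`
  entry `constantCoeff_flat_two_of_isSprungPair_of_isNewformOf` (`c♭ = −a₂² + 2a₂ + 1`);
* `sharp_ne_zero_and_flat_ne_zero_two_of_entireLFunction_one_ne_zero` — in analytic rank `0`
  (`L(E,1) ≠ 0`) both members of Sprung's pair at `2` are non-zero (`c♯, c♭ ≠ 0` on `a₂ ∈ {0, ±2}`);
* `isPollackPair_two_of_isSprungPair_of_frobeniusTrace_eq_zero` — **at `a₂ = 0` Sprung's pair at `2`
  IS a Pollack pair at `2`** (`IsPollackPair f 2 L♯ L♭`, the object `KobayashiMainConjecture W 2 ε`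
  quantifies over; congruences by `isSprungPair_zero_iff`, non-vanishing by the constant terms), and
  `exists_isPollackPair_two` — such a pair EXISTS (tree theorem `exists_isSprungPair_two`), so the
  typed conjecture `KobayashiMainConjecture W 2 ε` is NOT vacuous on `{good ss at 2, a₂ = 0, r_an = 0}`.

References: [Sprung2017] §1.1 (`N = n + 2` at `p = 2`), Thm. 1.12, Cor. 4.4, Cor. 4.11 (table);
[MazurTateTeitelbaum1986Invent] §I.4 (4.2); [Pollack2003] Prop. 6.18; [KuriharaOtsuki2006] Rem. 0.2 (3)
(`f(0) = L(E,1)/Ω_E`, `g(0) = 4L(E,1)/Ω_E` at `p = 2`, `a₂ = 0` — the same two constants up to sign and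
Pollack's normalisation).
-/

set_option autoImplicit false
-- the Theorems namespace of this sub repeats the summit name by design (D-0017 nested layout)
set_option linter.dupNamespace false

noncomputable section

open scoped Classical MatrixGroups ModularForm

open CongruenceSubgroup Polynomial WeierstrassCurve Literature.NumberTheory.EllipticCurves
  Literature.NumberTheory.EllipticCurves.ModularForms Literature.NumberTheory.EllipticCurves.Sprung2017
  Summit.BirchSwinnertonDyer.Rank1Residual.Supersingular

namespace Summit.BirchSwinnertonDyer.BirchSwinnertonDyer.Theorems

/-! ## §1. Two more unit sums of modular symbols (any good prime `p`) -/

section UnitSums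

variable {N : ℕ} [NeZero N] {f : CuspForm (Gamma0 N) 2} {p : ℕ} [Fact p.Prime]

/-- **`∑_{a ∈ (ℤ/p²)ˣ} [a/p]⁺_f = p·(a_p − 2)·[0]⁺_f`**: the units modulo `p²` lie `p`-to-`1` over the
units modulo `p` (`filter_castHom_eq_image`, `isUnit_iff_isUnit_castHom`), `[c/p + j]⁺ = [c/p]⁺`
(`ratPlusSymbol_add_intCast_eq`), and `∑_{c ∈ (ℤ/p)ˣ}[c/p]⁺ = (a_p − 2)[0]⁺`
(`sum_units_ratPlusSymbol_level_one_eq`). Level written `p^L`, `L = 1 + 1`.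
[cite: MazurTateTeitelbaum1986Invent, §I.4 (4.2)] -/
theorem sum_units_ratPlusSymbol_val_div_eq (hf : IsNewform0 f) (hQ : coeffField f = ⊥)
    (hpN : ¬ p ∣ N) {ap : ℤ} (hap : cuspCoeff f p = ap) (L : ℕ) (hL : L = 1 + 1) :
    ∑ u : (ZMod (p ^ L))ˣ, ratPlusSymbol f (((u : ZMod (p ^ L)).val : ℚ) / (p : ℚ) ^ 1) =
      (p : ℚ) * (((ap : ℚ) - 2) * ratPlusSymbol f 0) := by
  classical
  subst hL
  have hp : p.Prime := Fact.out
  haveI : NeZero (p ^ (1 + 1)) := ⟨pow_ne_zero _ hp.ne_zero⟩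
  haveI : NeZero (p ^ 1) := ⟨pow_ne_zero _ hp.ne_zero⟩
  have hp0 : (p : ℚ) ≠ 0 := by exact_mod_cast hp.ne_zero
  set F : ZMod (p ^ (1 + 1)) → ℚ := fun b ↦
    ratPlusSymbol f ((b.val : ℚ) / (p : ℚ) ^ 1) with hF
  set π := ZMod.castHom (pow_dvd_pow p (Nat.le_succ 1)) (ZMod (p ^ 1)) with hπ
  rw [sum_units_eq_sum_filter_isUnit (F := F), Finset.sum_filter,
    ← Finset.sum_fiberwise Finset.univ π
      (fun b : ZMod (p ^ (1 + 1)) ↦ if IsUnit b then F b else 0)]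
  have hfib : ∀ a : ZMod (p ^ 1),
      ∑ b ∈ Finset.univ.filter (fun b : ZMod (p ^ (1 + 1)) ↦ π b = a),
        (if IsUnit b then F b else 0) =
        if IsUnit a then (p : ℚ) * ratPlusSymbol f ((a.val : ℚ) / (p : ℚ) ^ 1) else 0 := by
    intro a
    have hiff : ∀ b ∈ Finset.univ.filter (fun b : ZMod (p ^ (1 + 1)) ↦ π b = a),
        IsUnit b ↔ IsUnit a := by
      intro b hb
      have hba : π b = a := (Finset.mem_filter.mp hb).2
      rw [isUnit_iff_isUnit_castHom (p := p) le_rfl (Nat.le_succ 1) b, ← hπ, hba]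
    by_cases ha : IsUnit a
    · rw [if_pos ha, Finset.sum_congr rfl fun b hb ↦ if_pos ((hiff b hb).mpr ha)]
      have hconst : ∀ b ∈ Finset.univ.filter (fun b : ZMod (p ^ (1 + 1)) ↦ π b = a),
          F b = ratPlusSymbol f ((a.val : ℚ) / (p : ℚ) ^ 1) := by
        intro b hb
        rw [hπ, filter_castHom_eq_image, Finset.mem_image] at hb
        obtain ⟨j, -, rfl⟩ := hb
        simp only [hF, val_classLift]
        have h : (((a.val + p ^ 1 * (j : ℕ) : ℕ) : ℚ) / (p : ℚ) ^ 1) =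
            (a.val : ℚ) / (p : ℚ) ^ 1 + (((j : ℕ) : ℤ) : ℚ) := by
          push_cast
          field_simp
        rw [h, ratPlusSymbol_add_intCast_eq]
      have hcard : (Finset.univ.filter (fun b : ZMod (p ^ (1 + 1)) ↦ π b = a)).card = p := by
        rw [hπ, filter_castHom_eq_image, Finset.card_image_of_injective _ ?_, Finset.card_univ,
          Fintype.card_fin]
        intro j j' h
        have hv := congr_arg ZMod.val h
        simp only [val_classLift] at hv
        exact Fin.ext (Nat.eq_of_mul_eq_mul_left (pow_pos hp.pos 1) (by omega))
      rw [Finset.sum_congr rfl hconst, Finset.sum_const, nsmul_eq_mul, hcard]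
    · rw [if_neg ha]
      exact Finset.sum_eq_zero fun b hb ↦ if_neg (fun hb' ↦ ha ((hiff b hb).mp hb'))
  simp only [hfib]
  rw [← Finset.sum_filter, ← Finset.mul_sum]
  have hone : ∑ a ∈ Finset.univ.filter (fun a : ZMod (p ^ 1) ↦ IsUnit a),
      ratPlusSymbol f ((a.val : ℚ) / (p : ℚ) ^ 1) = ((ap : ℚ) - 2) * ratPlusSymbol f 0 := by
    rw [← sum_units_eq_sum_filter_isUnit (F := fun b : ZMod (p ^ 1) ↦
      ratPlusSymbol f ((b.val : ℚ) / (p : ℚ) ^ 1))]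
    exact sum_units_ratPlusSymbol_level_one_eq hf hQ hpN hap 1 rfl
  rw [hone]

/-- **`∑_{a ∈ (ℤ/p³)ˣ} [a/p³]⁺_f = (a_p³ − 2a_p² + (1 − 2p)·a_p + 2p)·[0]⁺_f`** at a good prime:
group the units modulo `p³` by their residue `a` modulo `p²` (a unit); each fibre gives
`a_p[a/p²]⁺ − [a/p]⁺` (`sum_fiber_ratPlusSymbol_eq`); summing over `(ℤ/p²)ˣ` gives
`a_p·(a_p² − 2a_p − p + 1)[0]⁺ − p(a_p − 2)[0]⁺`. (Level `p^L`, `L = 2 + 1`: at `p = 2` this is the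
level `8 = 2^{1+2}` of `θ_1`.) [cite: MazurTateTeitelbaum1986Invent, §I.4 (4.2)] -/
theorem sum_units_ratPlusSymbol_level_three_eq (hf : IsNewform0 f) (hQ : coeffField f = ⊥)
    (hpN : ¬ p ∣ N) {ap : ℤ} (hap : cuspCoeff f p = ap) (L : ℕ) (hL : L = 2 + 1) :
    ∑ u : (ZMod (p ^ L))ˣ, ratPlusSymbol f (((u : ZMod (p ^ L)).val : ℚ) / (p : ℚ) ^ L) =
      ((ap : ℚ) ^ 3 - 2 * (ap : ℚ) ^ 2 + (1 - 2 * p) * ap + 2 * p) * ratPlusSymbol f 0 := by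
  classical
  subst hL
  have hp : p.Prime := Fact.out
  haveI : NeZero (p ^ (2 + 1)) := ⟨pow_ne_zero _ hp.ne_zero⟩
  haveI : NeZero (p ^ 2) := ⟨pow_ne_zero _ hp.ne_zero⟩
  have hp0 : (p : ℚ) ≠ 0 := by exact_mod_cast hp.ne_zero
  set F : ZMod (p ^ (2 + 1)) → ℚ := fun b ↦
    ratPlusSymbol f ((b.val : ℚ) / (p : ℚ) ^ (2 + 1)) with hF
  set π := ZMod.castHom (pow_dvd_pow p (Nat.le_succ 2)) (ZMod (p ^ 2)) with hπ
  rw [sum_units_eq_sum_filter_isUnit (F := F), Finset.sum_filter,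
    ← Finset.sum_fiberwise Finset.univ π
      (fun b : ZMod (p ^ (2 + 1)) ↦ if IsUnit b then F b else 0)]
  -- each fibre over a unit `a mod p²` contributes `a_p[a/p²]⁺ − [a/p]⁺`, the others `0`
  have hfib : ∀ a : ZMod (p ^ 2),
      ∑ b ∈ Finset.univ.filter (fun b : ZMod (p ^ (2 + 1)) ↦ π b = a),
        (if IsUnit b then F b else 0) =
        if IsUnit a then (ap : ℚ) * ratPlusSymbol f ((a.val : ℚ) / (p : ℚ) ^ 2) -
          ratPlusSymbol f ((a.val : ℚ) / (p : ℚ) ^ 1)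
        else 0 := by
    intro a
    have hiff : ∀ b ∈ Finset.univ.filter (fun b : ZMod (p ^ (2 + 1)) ↦ π b = a),
        IsUnit b ↔ IsUnit a := by
      intro b hb
      have hba : π b = a := (Finset.mem_filter.mp hb).2
      rw [isUnit_iff_isUnit_castHom (p := p) one_le_two (Nat.le_succ 2) b, ← hπ, hba]
    by_cases ha : IsUnit a
    · rw [if_pos ha, Finset.sum_congr rfl fun b hb ↦ if_pos ((hiff b hb).mpr ha), hπ,
        sum_fiber_ratPlusSymbol_eq hf hQ hpN hap 2 a]
      have harg : (p : ℚ) * ((a.val : ℚ) / (p : ℚ) ^ 2) = (a.val : ℚ) / (p : ℚ) ^ 1 := by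
        field_simp
      rw [harg]
    · rw [if_neg ha]
      exact Finset.sum_eq_zero fun b hb ↦ if_neg (fun hb' ↦ ha ((hiff b hb).mp hb'))
  simp only [hfib]
  rw [← Finset.sum_filter, Finset.sum_sub_distrib, ← Finset.mul_sum]
  -- the level-two unit sum and the descended sum, rewritten over the filter
  have htwo : ∑ a ∈ Finset.univ.filter (fun a : ZMod (p ^ 2) ↦ IsUnit a),
      ratPlusSymbol f ((a.val : ℚ) / (p : ℚ) ^ 2) =
        ((ap : ℚ) ^ 2 - 2 * ap - p + 1) * ratPlusSymbol f 0 := by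
    rw [← sum_units_eq_sum_filter_isUnit (F := fun b : ZMod (p ^ 2) ↦
      ratPlusSymbol f ((b.val : ℚ) / (p : ℚ) ^ 2))]
    exact sum_units_ratPlusSymbol_level_two_eq hf hQ hpN hap 2 rfl
  have hdown : ∑ a ∈ Finset.univ.filter (fun a : ZMod (p ^ 2) ↦ IsUnit a),
      ratPlusSymbol f ((a.val : ℚ) / (p : ℚ) ^ 1) = (p : ℚ) * (((ap : ℚ) - 2) * ratPlusSymbol f 0) := by
    rw [← sum_units_eq_sum_filter_isUnit (F := fun b : ZMod (p ^ 2) ↦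
      ratPlusSymbol f ((b.val : ℚ) / (p : ℚ) ^ 1))]
    exact sum_units_ratPlusSymbol_val_div_eq hf hQ hpN hap 2 rfl
  rw [htwo, hdown]
  ring

end UnitSums

/-! ## §2. The `♯` constant term at `p = 2` and non-vanishing in analytic rank `0` -/

section ConstantTerm

variable {N : ℕ} [NeZero N] {f : CuspForm (Gamma0 N) 2}

/-- At `p = 2` the level of `θ_1` is `2^{1 + e₀}`, `1 + e₀ = 2 + 1`. [folklore] -/
theorem one_add_cyclotomicExponent_two : 1 + cyclotomicExponent 2 = 2 + 1 := by
  unfold cyclotomicExponent; rw [if_pos rfl]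

/-- **`L♯(0) = (−a₂³ + 2a₂² + 3a₂ − 4)·[0]⁺_f` at `p = 2`** for ANY pair satisfying the level-`1`
clause of the Mazur–Tate characterisation of Sprung's pair (`θ_1 ≡ −(u_1 L♯ + v_1 L♭) = −L♯
(mod ω_1)`, so `θ_1(0) = −L♯(0)`): at `2`, `θ_1` is the level-`8` element and
`θ_1(0) = ∑_{a ∈ (ℤ/8)ˣ} [a/8]⁺ = (a₂³ − 2a₂² − 3a₂ + 4)·[0]⁺` (`sum_units_ratPlusSymbol_level_three_eq`
at `p = 2`). This is the `♯` entry of the row `p = 2` of Sprung's table of special values (the odd-`p`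
row `−a_p² + 2a_p + p − 1` is the tree's `constantCoeff_sharp_of_isCongrModOmega_one`).
[cite: Sprung2017, Cor. 4.4 and Cor. 4.11 (table of special values, row p = 2)] -/
theorem constantCoeff_sharp_two_of_isCongrModOmega_one (hf : IsNewform0 f)
    (hQ : coeffField f = ⊥) (hN : ¬ 2 ∣ N) {ap : ℤ} (hap : cuspCoeff f 2 = ap)
    {Lsharp Lflat : IwasawaAlgebra 2}
    (h1 : IsCongrModOmega 2 1 (mazurTateElement f 2 1) (-1)
      (toIwasawa 2 (sharpPoly ap 2 1) * Lsharp + toIwasawa 2 (flatPoly ap 2 1) * Lflat)) :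
    ((PowerSeries.constantCoeff Lsharp : ℤ_[2]) : ℚ_[2]) =
      (((-(ap : ℚ) ^ 3 + 2 * (ap : ℚ) ^ 2 + 3 * ap - 4) * ratPlusSymbol f 0 : ℚ) : ℚ_[2]) := by
  have h := algebraMap_eval_zero_eq_of_isCongrModOmega h1
  rw [mazurTateElement_eval_zero,
    sum_units_ratPlusSymbol_level_three_eq hf hQ hN hap _ one_add_cyclotomicExponent_two,
    map_add, constantCoeff_toIwasawa_mul, constantCoeff_toIwasawa_mul, sharpPoly_one,
    flatPoly_one] at h
  simp only [eval_neg, eval_one, eval_zero, Int.cast_zero, zero_mul, add_zero, Int.cast_one,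
    one_mul, Int.cast_neg] at h
  rw [eq_ratCast] at h
  push_cast at h ⊢
  linear_combination h

variable {W : WeierstrassCurve ℚ} [W.IsElliptic] [W.IsGloballyMinimal]

/-- **`L♯(0) = (−a₂(E)³ + 2a₂(E)² + 3a₂(E) − 4)·[0]⁺_f`** for ANY Sprung pair `(L♯, L♭)` at `2` of
the newform `f` of `E = W` with good reduction at `2` (`2 ∤ N`, `a₂(f) = a₂(E)` automatic).
[cite: Sprung2017, Thm. 1.12, Cor. 4.4 and Cor. 4.11 (row p = 2)] -/
theorem constantCoeff_sharp_two_of_isSprungPair_of_isNewformOf (hf : IsNewformOf W f)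
    (hgood : W.HasGoodReductionAtPrime 2) {Lsharp Lflat : IwasawaAlgebra 2}
    (hSP : IsSprungPair f 2 (W.frobeniusTrace 2) Lsharp Lflat) :
    ((PowerSeries.constantCoeff Lsharp : ℤ_[2]) : ℚ_[2]) =
      (((-(W.frobeniusTrace 2 : ℚ) ^ 3 + 2 * (W.frobeniusTrace 2 : ℚ) ^ 2 +
          3 * (W.frobeniusTrace 2) - 4) * ratPlusSymbol f 0 : ℚ) : ℚ_[2]) :=
  constantCoeff_sharp_two_of_isCongrModOmega_one hf.1 hf.coeffField_eq_bot
    (not_dvd_level_of_isNewformOf hf hgood) (cuspCoeff_eq_frobeniusTrace_of_isNewformOf_holds hf hgood)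
    (hSP 1)

/-- The two `p = 2` constants `c♯ = −a³ + 2a² + 3a − 4` and `c♭ = −a² + 2a + 1` are non-zero for
`a ∈ {0, 2, −2}` (values `−4, 2, 6` and `1, 1, −7`). [cite: Sprung2017, Cor. 4.11 (row p = 2)] -/
theorem sharpConst_two_ne_zero_and_flatConst_two_ne_zero {a : ℤ} (ha : a = 0 ∨ a = 2 ∨ a = -2) :
    (-(a : ℚ) ^ 3 + 2 * (a : ℚ) ^ 2 + 3 * a - 4) ≠ 0 ∧ (-(a : ℚ) ^ 2 + 2 * (a : ℚ) + 1) ≠ 0 := by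
  rcases ha with rfl | rfl | rfl <;> norm_num

/-- **In analytic rank `0` both members of Sprung's pair at `2` are non-zero.** For `f` the newform of
`E = W` with good supersingular reduction at `2` (`2 ∣ a₂(E)`, so `a₂ ∈ {0, ±2}` by
`frobeniusTrace_two_eq_zero_or`) and `L(E,1) ≠ 0` (`[0]⁺_f ≠ 0`): `L♯(0) = c♯[0]⁺_f ≠ 0` and
`L♭(0) = c♭[0]⁺_f ≠ 0`, hence `L♯ ≠ 0` and `L♭ ≠ 0`. (The odd-`p` sibling is
`sharp_ne_zero_and_flat_ne_zero_of_entireLFunction_one_ne_zero`.)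
[cite: Sprung2017, Cor. 4.11 (row p = 2)] -/
theorem sharp_ne_zero_and_flat_ne_zero_two_of_entireLFunction_one_ne_zero (hf : IsNewformOf W f)
    (hgood : W.HasGoodReductionAtPrime 2) (hss : (2 : ℤ) ∣ W.frobeniusTrace 2)
    (hL : W.entireLFunction 1 ≠ 0) {Lsharp Lflat : IwasawaAlgebra 2}
    (hSP : IsSprungPair f 2 (W.frobeniusTrace 2) Lsharp Lflat) : Lsharp ≠ 0 ∧ Lflat ≠ 0 := by
  have hs0 : ratPlusSymbol f 0 ≠ 0 := by
    intro h0
    apply hL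
    rw [hf.entireLFunction_one_eq, h0]
    simp
  obtain ⟨hcs, hcf⟩ := sharpConst_two_ne_zero_and_flatConst_two_ne_zero
    (frobeniusTrace_two_eq_zero_or W hgood hss)
  have hsharp0 := constantCoeff_sharp_two_of_isSprungPair_of_isNewformOf hf hgood hSP
  have hflat0 := constantCoeff_flat_two_of_isSprungPair_of_isNewformOf hf hgood hSP
  constructor
  · intro h0
    rw [h0, map_zero, PadicInt.coe_zero] at hsharp0
    have : ((-(W.frobeniusTrace 2 : ℚ) ^ 3 + 2 * (W.frobeniusTrace 2 : ℚ) ^ 2 +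
        3 * (W.frobeniusTrace 2) - 4) * ratPlusSymbol f 0 : ℚ) = 0 := by exact_mod_cast hsharp0.symm
    exact (mul_ne_zero hcs hs0) this
  · intro h0
    rw [h0, map_zero, PadicInt.coe_zero] at hflat0
    have : ((-(W.frobeniusTrace 2 : ℚ) ^ 2 + 2 * (W.frobeniusTrace 2 : ℚ) + 1) *
        ratPlusSymbol f 0 : ℚ) = 0 := by exact_mod_cast hflat0.symm
    exact (mul_ne_zero hcf hs0) this

end ConstantTerm

/-! ## §3. At `a₂ = 0`, Sprung's pair at `2` is a Pollack pair at `2` -/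

section PollackTwo

variable {N : ℕ} [NeZero N] {f : CuspForm (Gamma0 N) 2}
  {W : WeierstrassCurve ℚ} [W.IsElliptic] [W.IsGloballyMinimal]

/-- **At `a₂(E) = 0`, in analytic rank `0`, Sprung's pair at `2` is a Pollack pair at `2`**
(`IsPollackPair f 2 L♯ L♭`, POLLACK's labelling `L⁺ = L♯`, `L⁻ = L♭`): the congruence clauses are
`isSprungPair_zero_iff` (valid at every `p`), the two non-vanishing clauses are the rank-`0` constant
terms at `2`. This is the pair the typed conjecture `KobayashiMainConjecture W 2 ε` quantifies over.
[cite: Pollack2003, Prop. 6.18] [cite: Sprung2017, §3.1, Thm. 1.12 and Cor. 4.11] -/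
theorem isPollackPair_two_of_isSprungPair_of_frobeniusTrace_eq_zero (hf : IsNewformOf W f)
    (hgood : W.HasGoodReductionAtPrime 2) (ha : W.frobeniusTrace 2 = 0)
    (hL : W.entireLFunction 1 ≠ 0) {Lsharp Lflat : IwasawaAlgebra 2}
    (hSP : IsSprungPair f 2 (W.frobeniusTrace 2) Lsharp Lflat) : IsPollackPair f 2 Lsharp Lflat := by
  obtain ⟨hs, hfl⟩ := sharp_ne_zero_and_flat_ne_zero_two_of_entireLFunction_one_ne_zero hf hgood
    (by rw [ha]; exact dvd_zero 2) hL hSP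
  rw [ha] at hSP
  obtain ⟨hodd, heven⟩ := (isSprungPair_zero_iff f 2 Lsharp Lflat).mp hSP
  exact ⟨hs, hfl, hodd, heven⟩

/-- **A Pollack pair at `2` EXISTS for the newform of every `E/ℚ` with good reduction at `2`,
`a₂(E) = 0` and `L(E,1) ≠ 0`** — the `p = 2` companion of Pollack's existence theorem
(`pollack_exists_plusMinusPAdicLFunction`, typed with `p ≠ 2`): Sprung's pair at `2` exists by the
tree theorem `exists_isSprungPair_two` and is a Pollack pair by the previous theorem. Consequently
the typed `KobayashiMainConjecture W 2 ε` has an instance of every one of its universally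
quantified analytic binders on this class (non-vacuity).
[cite: Sprung2017, §1.1, Thm. 1.12 and Cor. 4.4] [cite: Pollack2003, Prop. 6.18] -/
theorem exists_isPollackPair_two (hf : IsNewformOf W f) (hgood : W.HasGoodReductionAtPrime 2)
    (ha : W.frobeniusTrace 2 = 0) (hL : W.entireLFunction 1 ≠ 0) :
    ∃ Lsharp Lflat : IwasawaAlgebra 2,
      IsSprungPair f 2 (W.frobeniusTrace 2) Lsharp Lflat ∧ IsPollackPair f 2 Lsharp Lflat := by
  obtain ⟨Ls, Lf, hSP⟩ := exists_isSprungPair_two hf hgood (by rw [ha]; exact dvd_zero 2)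
  exact ⟨Ls, Lf, hSP, isPollackPair_two_of_isSprungPair_of_frobeniusTrace_eq_zero hf hgood ha hL hSP⟩

end PollackTwo

end Summit.BirchSwinnertonDyer.BirchSwinnertonDyer.Theorems

end
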